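import Mathlib
import Literature.Computability.AlgebraicComplexity.NestFreeMatchingPoly
import Literature.Barriers.ValiantsHypothesis.MonotoneGapParseTrees
import Summits.ValiantsHypothesis.ValiantsHypothesis.Theorems.FifoMatchingNNDivisionHardFaceReading
import HarnessLib

/-!
# Route FifoMatching — crux `NNDivisionHard` (stmt-ValiantsHypothesis-21181): certificates with STACK-POWER cofactors
# `h = NC_n^k` compute every RAINBOW-PINNED face of `NFP_n` at polynomial cost

The residual test cofactor of the unsaturated tier (`…UnsaturatedTier`, `…FaceReading`): `h = NC_n^k`, a huge power of the
STACK twin — cheap (`L₊ = O(n³ + log k)`), hyper-degree, content-free, torus-homogeneous, and carrying no monomial inside a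
typical nest-free matching.  The face-reading rung needs a direction `w` that is GENERIC for `h`; here we supply the whole
family of RAINBOW directions `w = B·𝟙_R + w₁` (`R` = the rainbow arcs `(i, 2n−1−i)` = the arcs of `Fin.rev`, `w₁ ≤ 1` any 0/1
pin pattern, `B > n`):

* `rev_mem_noncrossingMatchings` — the rainbow `Fin.rev` is a noncrossing perfect matching of `[2n]`;
* `weight_arcExponent_eq_sum_openers` — `weight_w(χ_Q) = Σ_{arcs (i, Q i)} w(i, Q i)`;
* `weight_lt_of_ne_rev` — every other perfect matching `Q ≠ rev` has `weight_w(χ_Q) < weight_w(χ_rev)` (it contains at most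
  `n − 1` rainbow arcs, and `B > n ≥ Σ w₁`);
* `generic_noncrossingPow` — hence `k·χ_rev` is the UNIQUE `w`-maximal monomial of `NC_n^k` (and it occurs,
  `nsmul_rev_mem_support_noncrossingPow`);
* ★ `complexity_rainbowFace_le_of_stackPower` — for every `k`, `B > n`, `w₁ ≤ 1`:
  `L₊(top_w(NN_n)) ≤ 16((2n+1)(L₊(NN_n · NC_n^k)+1))² + 1` (`FaceReading.complexity_face_le_of_generic`).

WHAT REMAINS for «stack powers do not help the queue» (M-sized, next hand): identify ONE rainbow-pinned face as
`x^{pins} · NN_a` (for `n = 3a`: pins = the rainbow arc `(2a, 4a−1)`, the crossing arcs `(2a+1+t, 4a+t)`, `t < 2a−2`, and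
`(6a−2, 6a−1)`; a nest-free matching contains at most one rainbow arc, so the `w`-maximal ones are exactly `pins ⊔` a nest-free
matching of `[0, 2a)`), strip `x^{pins}` (JSS), rename, and invoke `NNMonotoneExpBound.exp_lower_bound`.

HONEST FRAMING: engine-level partial result in the monotone world; 21181 stays OPEN; VP ≠ VNP is NOT proved.
References: Jukna–Seiwert–Sergeev 2022 Thm 1 [JuknaSeiwertSergeev2022]; Chen–Deng–Du–Stanley–Yan 2007 §1 [ChenDengDuStanleyYan2007].
-/

noncomputable section

-- Sub = Summit single-conjunct layout: the duplicated namespace component is mandated by the tree.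
set_option linter.dupNamespace false
set_option autoImplicit false

namespace Summit.ValiantsHypothesis.ValiantsHypothesis.Theorems.FifoMatching.NNDivisionHard.StackPowers

open Finset MvPolynomial Literature.Computability.AlgebraicComplexity
open Literature.Barriers.ValiantsHypothesis
open Summit.ValiantsHypothesis.ValiantsHypothesis.Theorems.ZeroOneTransfer.Negative (topComponent)
open Summit.ValiantsHypothesis.ValiantsHypothesis.Theorems.FifoMatching.NNDivisionHard.FaceReading
  (complexity_face_le_of_generic)
open scoped NNReal BigOperators

variable {m : ℕ}

/-! ### The rainbow matching and rainbow weights -/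

/-- The rainbow `i ↦ m−1−i` (`Fin.rev`) is a noncrossing perfect matching of `Fin (2n)`. [cite: ChenDengDuStanleyYan2007, §1] -/
theorem rev_mem_noncrossingMatchings (n : ℕ) :
    (Fin.rev : Fin (2 * n) → Fin (2 * n)) ∈ noncrossingMatchings (2 * n) := by
  rw [mem_noncrossingMatchings, mem_perfectMatchings]
  refine ⟨⟨fun i => Fin.rev_rev i, fun i h => ?_⟩, fun i j hij hj hi => ?_⟩
  · have h1 := congrArg Fin.val h
    rw [Fin.val_rev] at h1
    omega
  · have hrev : Fin.rev j < Fin.rev i := Fin.rev_lt_rev.2 hij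
    exact absurd hi (lt_asymm hrev)

/-- The `w`-weight of the arc set of a perfect matching is the sum of `w` over its arcs `(i, Q i)`, `i` an opener. [folklore] -/
theorem weight_arcExponent_eq_sum_openers (w : Fin m × Fin m → ℕ) (Q : Fin m → Fin m) :
    Finsupp.weight w (arcExponent Q) = ∑ i ∈ openers Q, w (i, Q i) := by
  classical
  rw [arcExponent, map_sum]
  refine Finset.sum_congr rfl fun i _ => ?_
  rw [Finsupp.weight_single, one_smul]

/-- **Rainbow directions separate the rainbow.**  For `w = B·𝟙_R + w₁` with `w₁ ≤ 1` and `n < B`, every perfect matching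
`Q ≠ rev` of `[2n]` has `weight_w(χ_Q) < weight_w(χ_rev)`: `Q` has at most `n−1` rainbow arcs. [folklore] -/
theorem weight_lt_of_ne_rev {n B : ℕ} (hB : n < B) (w w₁ : Fin (2 * n) × Fin (2 * n) → ℕ) (hw₁ : ∀ e, w₁ e ≤ 1)
    (hw : ∀ e, w e = B * (if e.2 = Fin.rev e.1 then 1 else 0) + w₁ e)
    {Q : Fin (2 * n) → Fin (2 * n)} (hQ : Q ∈ perfectMatchings (2 * n)) (hne : Q ≠ Fin.rev) :
    Finsupp.weight w (arcExponent Q) < Finsupp.weight w (arcExponent (Fin.rev : Fin (2 * n) → Fin (2 * n))) := by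
  classical
  obtain ⟨hinv, hfp⟩ := mem_perfectMatchings.1 hQ
  have hrevPM : (Fin.rev : Fin (2 * n) → Fin (2 * n)) ∈ perfectMatchings (2 * n) :=
    noncrossingMatchings_subset_perfectMatchings (rev_mem_noncrossingMatchings n)
  -- some opener of `Q` is not matched by the rainbow
  have hex : ∃ i ∈ openers Q, Q i ≠ Fin.rev i := by
    by_contra hall
    push Not at hall
    apply hne
    funext j
    by_cases hj : j < Q j
    · exact hall j (mem_openers.2 hj)
    · have hj' : Q j < j := lt_of_le_of_ne (not_lt.1 hj) (hfp j)
      have hop : Q j ∈ openers Q := mem_openers.2 (by rw [hinv]; exact hj')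
      have h1 := hall (Q j) hop
      rw [hinv] at h1
      calc Q j = Fin.rev (Fin.rev (Q j)) := (Fin.rev_rev _).symm
        _ = Fin.rev j := by rw [← h1]
  obtain ⟨i₀, hi₀, hi₀ne⟩ := hex
  rw [weight_arcExponent_eq_sum_openers, weight_arcExponent_eq_sum_openers]
  -- the rainbow collects `B` on each of its `n` arcs
  have hrev : B * n ≤ ∑ i ∈ openers (Fin.rev : Fin (2 * n) → Fin (2 * n)), w (i, Fin.rev i) := by
    calc B * n = ∑ _i ∈ openers (Fin.rev : Fin (2 * n) → Fin (2 * n)), B := by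
          rw [Finset.sum_const, card_openers hrevPM, smul_eq_mul, mul_comm]
      _ ≤ _ := Finset.sum_le_sum fun i _ => by rw [hw]; simp
  -- `Q` collects at most `B (n-1) + n`
  have hQle : ∑ i ∈ openers Q, w (i, Q i) ≤ B * (n - 1) + n := by
    have hsplit : ∑ i ∈ openers Q, w (i, Q i) =
        ∑ i ∈ openers Q, B * (if Q i = Fin.rev i then 1 else 0) + ∑ i ∈ openers Q, w₁ (i, Q i) := by
      rw [← Finset.sum_add_distrib]
      exact Finset.sum_congr rfl fun i _ => hw _
    have h1 : ∑ i ∈ openers Q, w₁ (i, Q i) ≤ n :=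
      le_trans (Finset.sum_le_sum fun i _ => hw₁ _) (by rw [Finset.sum_const, card_openers hQ, smul_eq_mul, mul_one])
    have h2 : ∑ i ∈ openers Q, B * (if Q i = Fin.rev i then 1 else 0) ≤ B * (n - 1) := by
      rw [← Finset.mul_sum]
      refine Nat.mul_le_mul_left B ?_
      rw [Finset.sum_boole, Nat.cast_id]
      have hsub : (openers Q).filter (fun i => Q i = Fin.rev i) ⊆ (openers Q).erase i₀ := by
        intro i hi
        rw [Finset.mem_filter] at hi
        exact Finset.mem_erase.2 ⟨fun h => hi₀ne (h ▸ hi.2), hi.1⟩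
      exact (Finset.card_le_card hsub).trans (by rw [Finset.card_erase_of_mem hi₀, card_openers hQ])
    omega
  have hn : 1 ≤ n := by
    have := card_openers hQ
    have hpos : 0 < (openers Q).card := Finset.card_pos.2 ⟨i₀, hi₀⟩
    omega
  have key : B * (n - 1) + n < B * n := by
    have : B * (n - 1) + B = B * n := by
      rw [← Nat.mul_succ, Nat.succ_eq_add_one, Nat.sub_add_cancel hn]
    omega
  omega

/-! ### Genericity of rainbow directions for the stack powers -/

/-- The pure rainbow monomial `k · χ_rev` occurs in `NC_n^k`. [folklore] -/
theorem nsmul_rev_mem_support_noncrossingPow (n k : ℕ) :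
    k • arcExponent (Fin.rev : Fin (2 * n) → Fin (2 * n)) ∈ ((noncrossingMatchingPoly n ℝ≥0) ^ k).support := by
  induction k with
  | zero =>
    rw [pow_zero, zero_smul, mem_support_iff, coeff_one, if_pos rfl]
    exact one_ne_zero
  | succ k ih =>
    rw [pow_succ, JerrumSnir.support_mul_eq, succ_nsmul]
    refine Finset.add_mem_add ih ?_
    rw [noncrossingMatchingPoly_eq_sum_arcMonomial,
      support_sum_arcMonomial noncrossingMatchings_subset_perfectMatchings]
    exact Finset.mem_image_of_mem _ (rev_mem_noncrossingMatchings n)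

/-- **Genericity**: in a rainbow direction, every monomial of `NC_n^k` weighs at most `k · weight(χ_rev)`, with equality only
for `k · χ_rev`. [folklore] -/
theorem generic_noncrossingPow {n B : ℕ} (hB : n < B) (w w₁ : Fin (2 * n) × Fin (2 * n) → ℕ) (hw₁ : ∀ e, w₁ e ≤ 1)
    (hw : ∀ e, w e = B * (if e.2 = Fin.rev e.1 then 1 else 0) + w₁ e) (k : ℕ) :
    ∀ e ∈ ((noncrossingMatchingPoly n ℝ≥0) ^ k).support,
      Finsupp.weight w e ≤ k * Finsupp.weight w (arcExponent (Fin.rev : Fin (2 * n) → Fin (2 * n))) ∧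
      (Finsupp.weight w e = k * Finsupp.weight w (arcExponent (Fin.rev : Fin (2 * n) → Fin (2 * n))) →
        e = k • arcExponent (Fin.rev : Fin (2 * n) → Fin (2 * n))) := by
  classical
  induction k with
  | zero =>
    intro e he
    rw [pow_zero] at he
    have : e = 0 := by rw [support_one] at he; simpa using he
    subst this
    simp
  | succ k ih =>
    intro e he
    rw [pow_succ] at he
    obtain ⟨a, ha, b, hb, rfl⟩ := Finset.mem_add.1 (support_mul _ _ he)
    rw [noncrossingMatchingPoly_eq_sum_arcMonomial,
      support_sum_arcMonomial noncrossingMatchings_subset_perfectMatchings, Finset.mem_image] at hb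
    obtain ⟨Q, hQ, rfl⟩ := hb
    have hQP := noncrossingMatchings_subset_perfectMatchings hQ
    obtain ⟨hle, heq⟩ := ih a ha
    set W := Finsupp.weight w (arcExponent (Fin.rev : Fin (2 * n) → Fin (2 * n))) with hW
    have hQle : Finsupp.weight w (arcExponent Q) ≤ W := by
      by_cases hQe : Q = Fin.rev
      · rw [hQe]
      · exact (weight_lt_of_ne_rev hB w w₁ hw₁ hw hQP hQe).le
    rw [map_add]
    have hkW : (k + 1) * W = k * W + W := by ring
    refine ⟨by rw [hkW]; exact Nat.add_le_add hle hQle, fun hsum => ?_⟩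
    have ha' : Finsupp.weight w a = k * W := by rw [hkW] at hsum; omega
    have hb' : Finsupp.weight w (arcExponent Q) = W := by rw [hkW] at hsum; omega
    have hQe : Q = Fin.rev := by
      by_contra hQe
      exact absurd hb' (weight_lt_of_ne_rev hB w w₁ hw₁ hw hQP hQe).ne
    rw [heq ha', hQe, succ_nsmul]

/-! ### The face-reading consequence -/

/-- ★ **STACK-POWER CERTIFICATES READ EVERY RAINBOW-PINNED FACE.**  For every `k`, every `B > n` and every 0/1 pin pattern
`w₁`, with `w = B·𝟙_R + w₁`: `L₊(top_w(NN_n)) ≤ 16((2n+1)(L₊(NN_n · NC_n^k)+1))² + 1`.  (So `(NC_n^k, NN_n · NC_n^k)` is not a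
quasi-polynomial certificate as soon as ONE rainbow-pinned face polynomial of `NN_n` is super-quasi-polynomially hard — e.g.
the face `x^{pins} · NN_{n/3}` described in the module docstring.) [cite: JuknaSeiwertSergeev2022, Thm 1] -/
theorem complexity_rainbowFace_le_of_stackPower {n B : ℕ} (hB : n < B) (w w₁ : Fin (2 * n) × Fin (2 * n) → ℕ)
    (hw₁ : ∀ e, w₁ e ≤ 1) (hw : ∀ e, w e = B * (if e.2 = Fin.rev e.1 then 1 else 0) + w₁ e) (k : ℕ) :
    complexity (topComponent w (nestFreeMatchingPoly n ℝ≥0)) ≤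
      16 * ((2 * n + 1) * (complexity (nestFreeMatchingPoly n ℝ≥0 * (noncrossingMatchingPoly n ℝ≥0) ^ k) + 1)) ^ 2 + 1 := by
  refine complexity_face_le_of_generic n w ((noncrossingMatchingPoly n ℝ≥0) ^ k)
    (nsmul_rev_mem_support_noncrossingPow n k) fun e' he' hne => ?_
  obtain ⟨hle, heq⟩ := generic_noncrossingPow hB w w₁ hw₁ hw k e' he'
  rw [map_nsmul, smul_eq_mul]
  exact lt_of_le_of_ne hle fun h => hne (heq h)

end Summit.ValiantsHypothesis.ValiantsHypothesis.Theorems.FifoMatching.NNDivisionHard.StackPowers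

end
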